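import Literature.Analysis.FluidPDE.KochTataruKernel
import Literature.Analysis.FluidPDE.HeatNewtonOffDiagonal
import HarnessLib

/-!
# The Oseen tensor kernel of `e^{τΔ}P` in physical space: the weights and the time integral of
# the Gaussian Hessian

Analysis/FluidPDE definitions-layer file for the proof of the named fact
`Literature.Analysis.FluidPDE.bradshawGrujicKukavica2015_local_analyticity_radius`
(Bradshaw–Grujić–Kukavica 2015, Thm. 2.3, §4: the projected forcing `e^{(t-s)Δ}P f₀(s)` of the
localised equation, written with a physical-space kernel so as to be continued in the space
variable). The kernel of `e^{τΔ}P` is the **Oseen tensor**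
(Lemarié-Rieusset 2016, §6.2; Oseen 1911):

  `𝒪_τ(z) a = (G_τ(z) - A₁(τ, z)) a + A(τ, z) ⟪z, a⟫ z`,
  `A(τ, z) = ∫_τ^∞ G_s(z)/(4s²) ds` (`oseenWeightA`, `KochTataru.lean`),
  `A₁(τ, z) = ∫_τ^∞ G_s(z)/(2s) ds` (`oseenWeightA1`, this file),

obtained from `P = Id - ∇Δ⁻¹div`, `Δ⁻¹e^{τΔ} = -∫_τ^∞ e^{sΔ} ds` and
`∂ᵢ∂ⱼ G_s(z) = G_s(z)(zᵢzⱼ/(4s²) - δᵢⱼ/(2s))`. This file supplies: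

* `oseenWeightA1` with its absolute convergence and the bound
  `0 ≤ A₁(τ,z) ≤ C (τ + ‖z‖²)^{-d/2}` in positive dimension (`exists_oseenWeightA1_le`);
* `integral_Ioi_heatKernelHessWeight` — **the time integral of the Gaussian Hessian**:
  `∫_τ^∞ ∂ᵥ∂_cG_s(z) ds = -⟪v,c⟫ A₁(τ,z) + ⟪z,c⟫⟪z,v⟫ A(τ,z)` (`heatKernelHessWeight` of
  `HeatNewtonOffDiagonal.lean`), with the integrability of `s ↦ ∂ᵥ∂_cG_s(z)` on `(τ, ∞)`;
* `oseenTensor τ z a` and its unfolding / component lemmas.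

The identity `e^{τΔ}P G (x) = ∫ 𝒪_τ(x - y) G(y) dy` for test fields `G` is proved in the
companion file `OseenTensorRepresentation.lean`.

## References

* C. W. Oseen, *Hydrodynamik* (1927), §5 (the tensor). [folklore]
* P. G. Lemarié-Rieusset, *The Navier–Stokes Problem in the 21st Century* (2016), §6.2 (the Oseen
  tensor `e^{tΔ}P`). [LemarieRieusset2016]
* H. Koch, D. Tataru, Adv. Math. 157 (2001), §2 (6)–(8). [KochTataruAdvMath2001]
-/

noncomputable section

open MeasureTheory Set Filter Metric Real
open _root_.Topology
open scoped InnerProductSpace RealInnerProductSpace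

namespace Literature.Analysis.FluidPDE

open UnboundedOperators (heatKernel)

variable {E : Type*} [NormedAddCommGroup E] [InnerProductSpace ℝ E]

/-! ### The weight `A₁(τ, z) = ∫_τ^∞ G_s(z)/(2s) ds` -/

/-- **The Gaussian weight `A₁`** of the Oseen tensor: `A₁(τ, z) = ∫_τ^∞ G_s(z)/(2s) ds`, the
coefficient of `-δᵢⱼ` in `∫_τ^∞ ∂ᵢ∂ⱼG_s(z) ds` (absolutely convergent for `τ > 0` in positive
dimension; junk for `τ ≤ 0`). [cite: LemarieRieusset2016, §6.2] -/
def oseenWeightA1 (τ : ℝ) (z : E) : ℝ :=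
  ∫ s in Ioi τ, heatKernel s z / (2 * s ^ 1)

/-- Unfolding lemma (with `s¹ = s`). [folklore] -/
theorem oseenWeightA1_eq (τ : ℝ) (z : E) :
    oseenWeightA1 τ z = ∫ s in Ioi τ, heatKernel s z / (2 * s) := by
  simp [oseenWeightA1]

/-- **Absolute convergence and parabolic bound for `A₁`** in positive dimension: there is
`C = C(E) > 0` with `s ↦ G_s(z)/(2s)` integrable on `(τ, ∞)` and
`0 ≤ A₁(τ, z) ≤ C (τ + ‖z‖²)^{-d/2}` for all `τ > 0`, `z` (as for `A`, `B` in
`KochTataruKernel.lean`, with `∫_τ^∞ (s + ‖z‖²)^{-d/2-1} ds = (τ + ‖z‖²)^{-d/2}/(d/2)`).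
[cite: KochTataruAdvMath2001, §2 (8)] -/
theorem exists_oseenWeightA1_le (hE : 0 < Module.finrank ℝ E) :
    ∃ C : ℝ, 0 < C ∧ ∀ {τ : ℝ}, 0 < τ → ∀ z : E,
      IntegrableOn (fun s => heatKernel s z / (2 * s ^ 1)) (Ioi τ) ∧
        0 ≤ oseenWeightA1 τ z ∧
        oseenWeightA1 τ z ≤ C * (τ + ‖z‖ ^ 2) ^ (-((Module.finrank ℝ E : ℝ) / 2)) := by
  set d : ℝ := (Module.finrank ℝ E : ℝ) with hd
  have hd0 : 0 < d := by rw [hd]; exact_mod_cast hE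
  obtain ⟨C₀, hC₀, hG⟩ := exists_heatKernel_le_rpow (E := E) (d / 2 + 1)
  set a : ℝ := -(d / 2 + 1) with ha
  have ha1 : a < -1 := by rw [ha]; linarith
  have hpos : 0 < d / 2 := by linarith
  refine ⟨C₀ / 2 / (d / 2), by positivity, fun {τ} hτ z => ?_⟩
  have hτρ : 0 < τ + ‖z‖ ^ 2 := by positivity
  obtain ⟨hint, hval⟩ := integral_Ioi_add_rpow (ρ := ‖z‖ ^ 2) ha1 hτρ
  have hpt : ∀ s ∈ Ioi τ, heatKernel s z / (2 * s ^ 1) ≤ C₀ / 2 * (s + ‖z‖ ^ 2) ^ a := by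
    intro s hs
    have hs0 : 0 < s := hτ.trans hs
    have h1 := hG hs0 z
    have hse : s ^ (d / 2 + 1 - d / 2) = s := by
      rw [add_sub_cancel_left, Real.rpow_one]
    rw [hse] at h1
    rw [pow_one, div_le_iff₀ (by positivity)]
    calc heatKernel s z ≤ C₀ * s * (s + ‖z‖ ^ 2) ^ (-(d / 2 + 1)) := h1
      _ = C₀ / 2 * (s + ‖z‖ ^ 2) ^ a * (2 * s) := by rw [ha]; ring
  have hmeas : AEStronglyMeasurable (fun s => heatKernel s z / (2 * s ^ 1)) (volume.restrict (Ioi τ)) := by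
    refine ContinuousOn.aestronglyMeasurable ?_ measurableSet_Ioi
    refine ((continuousOn_heatKernel_time z).mono (Ioi_subset_Ioi hτ.le)).div (by fun_prop) ?_
    intro s hs
    exact mul_ne_zero two_ne_zero (pow_ne_zero _ (hτ.trans hs).ne')
  have hnn : ∀ s ∈ Ioi τ, 0 ≤ heatKernel s z / (2 * s ^ 1) := fun s hs =>
    div_nonneg (UnboundedOperators.heatKernel_pos (hτ.trans hs) z).le
      (mul_nonneg zero_le_two (pow_nonneg (hτ.trans hs).le _))
  have hint' : IntegrableOn (fun s => C₀ / 2 * (s + ‖z‖ ^ 2) ^ a) (Ioi τ) := hint.const_mul _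
  have hdom : IntegrableOn (fun s => heatKernel s z / (2 * s ^ 1)) (Ioi τ) :=
    hint'.mono' hmeas ((ae_restrict_iff' measurableSet_Ioi).2 (Eventually.of_forall fun s hs => by
      rw [Real.norm_of_nonneg (hnn s hs)]; exact hpt s hs))
  refine ⟨hdom, setIntegral_nonneg measurableSet_Ioi hnn, ?_⟩
  calc oseenWeightA1 τ z = ∫ s in Ioi τ, heatKernel s z / (2 * s ^ 1) := rfl
    _ ≤ ∫ s in Ioi τ, C₀ / 2 * (s + ‖z‖ ^ 2) ^ a := setIntegral_mono_on hdom hint' measurableSet_Ioi hpt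
    _ = C₀ / 2 * ((τ + ‖z‖ ^ 2) ^ (a + 1) / (-(a + 1))) := by rw [integral_const_mul, hval]
    _ = C₀ / 2 / (d / 2) * (τ + ‖z‖ ^ 2) ^ (-(d / 2)) := by
        rw [show a + 1 = -(d / 2) by rw [ha]; ring, neg_neg]
        field_simp

/-! ### The time integral of the Gaussian Hessian -/

/-- **The Hessian weight splits into the two Gaussian moments**:
`∂ᵥ∂_cG_s(z) = -⟪v,c⟫ G_s(z)/(2s) + ⟪z,c⟫⟪z,v⟫ G_s(z)/(4s²)` (`s ≠ 0`). [folklore] -/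
theorem heatKernelHessWeight_eq (s : ℝ) (v c z : E) :
    heatKernelHessWeight s v c z =
      -⟪v, c⟫ * (heatKernel s z / (2 * s ^ 1)) + ⟪z, c⟫ * ⟪z, v⟫ * (heatKernel s z / (4 * s ^ 2)) := by
  unfold heatKernelHessWeight
  rcases eq_or_ne s 0 with rfl | hs
  · simp
  · field_simp
    ring

/-- **The time integral of the Gaussian Hessian**: for `τ > 0` (positive dimension),
`s ↦ ∂ᵥ∂_cG_s(z)` is integrable on `(τ, ∞)` and
`∫_τ^∞ ∂ᵥ∂_cG_s(z) ds = -⟪v,c⟫ A₁(τ,z) + ⟪z,c⟫⟪z,v⟫ A(τ,z)`. [cite: LemarieRieusset2016, §6.2] -/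
theorem integral_Ioi_heatKernelHessWeight (hE : 0 < Module.finrank ℝ E) {τ : ℝ} (hτ : 0 < τ)
    (v c z : E) :
    IntegrableOn (fun s => heatKernelHessWeight s v c z) (Ioi τ) ∧
      ∫ s in Ioi τ, heatKernelHessWeight s v c z =
        -⟪v, c⟫ * oseenWeightA1 τ z + ⟪z, c⟫ * ⟪z, v⟫ * oseenWeightA τ z := by
  obtain ⟨CA, _, hA⟩ := exists_oseenWeightA_le (E := E)
  obtain ⟨CA1, _, hA1⟩ := exists_oseenWeightA1_le (E := E) hE
  obtain ⟨hiA, -, -⟩ := hA hτ z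
  obtain ⟨hiA1, -, -⟩ := hA1 hτ z
  have h1 : IntegrableOn (fun s => -⟪v, c⟫ * (heatKernel s z / (2 * s ^ 1))) (Ioi τ) := hiA1.const_mul _
  have h2 : IntegrableOn (fun s => ⟪z, c⟫ * ⟪z, v⟫ * (heatKernel s z / (4 * s ^ 2))) (Ioi τ) :=
    hiA.const_mul _
  have hsum : IntegrableOn (fun s => -⟪v, c⟫ * (heatKernel s z / (2 * s ^ 1)) +
      ⟪z, c⟫ * ⟪z, v⟫ * (heatKernel s z / (4 * s ^ 2))) (Ioi τ) := h1.add h2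
  have heq : (fun s => heatKernelHessWeight s v c z) = fun s =>
      -⟪v, c⟫ * (heatKernel s z / (2 * s ^ 1)) + ⟪z, c⟫ * ⟪z, v⟫ * (heatKernel s z / (4 * s ^ 2)) :=
    funext fun s => heatKernelHessWeight_eq s v c z
  rw [heq]
  refine ⟨hsum, ?_⟩
  rw [integral_add h1 h2, integral_const_mul, integral_const_mul]
  rfl

/-! ### The Oseen tensor -/

/-- **The Oseen tensor**, the physical-space kernel of `e^{τΔ}P`:
`oseenTensor τ z a = (G_τ(z) - A₁(τ,z)) a + A(τ,z) ⟪z, a⟫ z`. [cite: LemarieRieusset2016, §6.2] -/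
def oseenTensor (τ : ℝ) (z a : E) : E :=
  (heatKernel τ z - oseenWeightA1 τ z) • a + (oseenWeightA τ z * ⟪z, a⟫) • z

/-- Unfolding lemma. [folklore] -/
theorem oseenTensor_apply (τ : ℝ) (z a : E) :
    oseenTensor τ z a = (heatKernel τ z - oseenWeightA1 τ z) • a + (oseenWeightA τ z * ⟪z, a⟫) • z := rfl

/-- **Components of the Oseen tensor**: `⟪𝒪_τ(z) a, w⟫ = (G_τ(z) - A₁(τ,z))⟪a, w⟫ + A(τ,z)⟪z, a⟫⟪z, w⟫`.
[folklore] -/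
theorem inner_oseenTensor (τ : ℝ) (z a w : E) :
    ⟪oseenTensor τ z a, w⟫ = (heatKernel τ z - oseenWeightA1 τ z) * ⟪a, w⟫ +
      oseenWeightA τ z * ⟪z, a⟫ * ⟪z, w⟫ := by
  rw [oseenTensor_apply, inner_add_left, inner_smul_left, inner_smul_left]
  simp [mul_assoc]

/-- The Oseen tensor is linear in the tensor slot (zero). [folklore] -/
@[simp] theorem oseenTensor_zero (τ : ℝ) (z : E) : oseenTensor τ z 0 = 0 := by
  simp [oseenTensor_apply]

/-- **A bound for the Oseen tensor**: `‖𝒪_τ(z) a‖ ≤ (G_τ(z) + A₁(τ,z) + A(τ,z)‖z‖²) ‖a‖`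
(`τ > 0`, so that the weights are non-negative). [folklore] -/
theorem norm_oseenTensor_le (hE : 0 < Module.finrank ℝ E) {τ : ℝ} (hτ : 0 < τ) (z a : E) :
    ‖oseenTensor τ z a‖ ≤ (heatKernel τ z + oseenWeightA1 τ z + oseenWeightA τ z * ‖z‖ ^ 2) * ‖a‖ := by
  obtain ⟨CA, _, hA⟩ := exists_oseenWeightA_le (E := E)
  obtain ⟨CA1, _, hA1⟩ := exists_oseenWeightA1_le (E := E) hE
  obtain ⟨-, hA0, -⟩ := hA hτ z
  obtain ⟨-, hA10, -⟩ := hA1 hτ z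
  have hG0 := (UnboundedOperators.heatKernel_pos hτ z).le
  rw [oseenTensor_apply]
  calc ‖(heatKernel τ z - oseenWeightA1 τ z) • a + (oseenWeightA τ z * ⟪z, a⟫) • z‖
      ≤ ‖(heatKernel τ z - oseenWeightA1 τ z) • a‖ + ‖(oseenWeightA τ z * ⟪z, a⟫) • z‖ := norm_add_le _ _
    _ ≤ (heatKernel τ z + oseenWeightA1 τ z) * ‖a‖ + oseenWeightA τ z * (‖z‖ * ‖a‖) * ‖z‖ := by
        rw [norm_smul, norm_smul, Real.norm_eq_abs, Real.norm_eq_abs, abs_mul, abs_of_nonneg hA0]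
        gcongr
        · exact (abs_sub _ _).trans (by rw [abs_of_nonneg hG0, abs_of_nonneg hA10])
        · exact abs_real_inner_le_norm z a
    _ = (heatKernel τ z + oseenWeightA1 τ z + oseenWeightA τ z * ‖z‖ ^ 2) * ‖a‖ := by ring

end Literature.Analysis.FluidPDE
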